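import Literature.Analysis.Complex.ArcLogarithmPairing
import Literature.Analysis.Complex.DbarAlongCalculus
import HarnessLib

/-!
# The weak solution of the divisor of an arc, in the plane (Forster §20.4–20.5)

Topic `Literature/Analysis/Complex`, sequel of `ArcLogarithmPairing` (the cut logarithm
`w_{a,b}(z) = (2πi)⁻¹ log((z - b)/(z - a))`, holomorphic off `[a, b]`, `exp(2πi w_{a,b}) = (z-b)/(z-a)`).
O. Forster, *Lectures on Riemann Surfaces*, GTM 81 (1981), 20.4–20.5, as printed: for a curve `c` from
`a` to `b` inside the disc `{|z| < r}` and a cut-off `ψ` with `ψ = 1` on `{|z| ≤ r}`, `ψ = 0` near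
`{|z| ≥ r'}`,

  `f₀ = exp(ψ log((z-b)/(z-a)))` on `{r < |z| < 1}`,   `f₀ = (z-b)/(z-a)` on `{|z| ≤ r}`,

«is a weak solution of the divisor `∂c`» (20.4: smooth off `a`, `= (z-b)/(z-a) ·` (smooth nonvanishing)
near the endpoints, nonvanishing elsewhere), equal to `1` where `ψ = 0`. This file defines that function
for a straight arc and a general cut-off `ρ` (`arcUnit ρ a b c₀ r₁`: `(z-b)/(z-a)` on the disc
`B(c₀, r₁)` containing `a, b`, `exp(2πi ρ w_{a,b})` outside), and proves, for `a, b ∈ B(c₀, r₀)`,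
`r₀ < r₁ < r₂`, `ρ = 1` on `B(c₀, r₂)`:

* `arcUnit_eq_exp_of_not_mem_segment` — off the cut `[a,b]` it is `exp(2πi ρ w_{a,b})` (the two
  definitions agree on `B(c₀, r₂) ∖ [a,b]`);
* `contDiffAt_arcUnit` — it is `C^∞` (over `ℝ`) at every `z ≠ a`; `arcUnit_ne_zero` — nonvanishing off
  `{a, b}`; `arcUnit_eventuallyEq_div` — `= (z-b)/(z-a)` near the disc `B(c₀, r₁)`;
  `arcUnit_eq_one` — `= 1` where `ρ = 0`;
* **`dbarAlong_arcUnit`** — the logarithmic `∂̄`-derivative: `∂̄u = 2πi · (∂̄ρ · w_{a,b}) · u` at every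
  `z ≠ a` (Forster: `f⁻¹ ∂̄f = ∂̄(ψ log …)`, the smooth `(0,1)`-form `σ` of the weak solution);
* `contDiff_dbarAlong_mul_arcLog`, `hasCompactSupport_dbarAlong_mul_arcLog`,
  `tsupport_dbarAlong_mul_arcLog_subset` — the coefficient `g = ∂̄ρ · w_{a,b}` of `σ = g dz̄` is `C^∞`
  with compact support inside `supp ρ` (it vanishes on `B(c₀, r₂)`).

Also two chain rules for the Wirtinger derivative `∂̄ = dbarAlong 1` with a holomorphic outer function
(`dbarAlong_one_comp_of_differentiableAt`, `dbarAlong_one_cexp`). Everything is proved; no named facts.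

## References

* O. Forster, *Lectures on Riemann Surfaces*, GTM 81, Springer (1981), 20.4 (weak solutions of `∂c`),
  20.5 (proof, part (a): the function `f₀`). Held text `book:forsternd-lectures-reimann-surfaces`
  (scan pp. 134–136). [Forster1981]
-/

noncomputable section

open MeasureTheory Set Filter Function Complex Metric Topology
open scoped Real ComplexConjugate ContDiff

namespace Literature.Analysis.Complex

/-! ### Chain rules for `∂̄` with a holomorphic outer function -/

/-- **`∂̄(F ∘ h) = F′(h) · ∂̄h`** for `F` complex-differentiable at `h w` and `h` real-differentiable at
`w` (the differential of `F` is multiplication by `F′`, which commutes with the `ℂ`-linear combination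
defining `∂̄`). [cite: HormanderSCV1973, §1.1] -/
theorem dbarAlong_one_comp_of_differentiableAt {F h : ℂ → ℂ} {w : ℂ}
    (hF : DifferentiableAt ℂ F (h w)) (hh : DifferentiableAt ℝ h w) :
    dbarAlong 1 (fun y ↦ F (h y)) w = deriv F (h w) * dbarAlong 1 h w := by
  have H : HasFDerivAt (fun y ↦ F (h y)) (deriv F (h w) • fderiv ℝ h w) w :=
    hF.hasDerivAt.comp_hasFDerivAt w hh.hasFDerivAt
  rw [dbarAlong_one, dbarAlong_one, H.fderiv]
  simp only [FunLike.coe_smul, Pi.smul_apply, smul_eq_mul]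
  ring

/-- **`∂̄(exp h) = exp(h) · ∂̄h`** for `h` real-differentiable at `w`. [cite: HormanderSCV1973, §1.1] -/
theorem dbarAlong_one_cexp {h : ℂ → ℂ} {w : ℂ} (hh : DifferentiableAt ℝ h w) :
    dbarAlong 1 (fun y ↦ Complex.exp (h y)) w = Complex.exp (h w) * dbarAlong 1 h w := by
  rw [dbarAlong_one_comp_of_differentiableAt Complex.differentiable_exp.differentiableAt hh,
    Complex.deriv_exp]

/-! ### The coefficient `g = ∂̄ρ · w_{a,b}` -/

section Coefficient

variable {ρ : ℂ → ℂ} {a b c₀ : ℂ} {r₀ r₂ : ℝ}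

/-- Segments are closed. [folklore] -/
private theorem isClosed_segment' (a b : ℂ) : IsClosed (segment ℝ a b) := by
  rw [segment_eq_image']
  exact (isCompact_Icc.image
    (continuous_const.add (continuous_id.smul continuous_const))).isClosed

/-- A segment with endpoints in `B(c₀, r₀)` lies in every larger concentric disc. [folklore] -/
private theorem not_mem_segment_of_not_mem_ball (h₀₂ : r₀ < r₂) (ha : a ∈ ball c₀ r₀)
    (hb : b ∈ ball c₀ r₀) {z : ℂ} (hz : z ∉ ball c₀ r₂) : z ∉ segment ℝ a b := fun h ↦
  hz (ball_subset_ball h₀₂.le ((convex_ball c₀ r₀).segment_subset ha hb h))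

/-- **The coefficient `∂̄ρ · w_{a,b}` is `C^∞`** when `ρ ∈ C^∞` equals `1` on a disc `B(c₀, r₂)`
containing `[a, b]` (it vanishes on that disc, and `w_{a,b}` is smooth off the cut).
[cite: Forster1981, §20.5, proof (a)] -/
theorem contDiff_dbarAlong_mul_arcLog (hρ : ContDiff ℝ ∞ ρ) (h₀₂ : r₀ < r₂)
    (hρ1 : ∀ z ∈ ball c₀ r₂, ρ z = 1) (ha : a ∈ ball c₀ r₀) (hb : b ∈ ball c₀ r₀) :
    ContDiff ℝ ∞ fun z ↦ dbarAlong 1 ρ z * arcLog a b z := by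
  rw [contDiff_iff_contDiffAt]
  intro z
  by_cases hz : z ∈ ball c₀ r₂
  · have h0 : (fun z ↦ dbarAlong 1 ρ z * arcLog a b z) =ᶠ[𝓝 z] fun _ ↦ 0 := by
      filter_upwards [isOpen_ball.mem_nhds hz] with y hy
      rw [dbarAlong_eq_zero_of_eqOn_ball hρ1 hy, zero_mul]
    exact contDiffAt_const.congr_of_eventuallyEq h0
  · exact ((contDiff_infty_dbarAlong hρ 1).contDiffAt).mul
      (contDiffAt_arcLog (not_mem_segment_of_not_mem_ball h₀₂ ha hb hz))

/-- The coefficient `∂̄ρ · w_{a,b}` has compact support if `ρ` has. [cite: Forster1981, §20.5] -/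
theorem hasCompactSupport_dbarAlong_mul_arcLog (hρc : HasCompactSupport ρ) (a b : ℂ) :
    HasCompactSupport fun z ↦ dbarAlong 1 ρ z * arcLog a b z :=
  hasCompactSupport_dbarAlong_mul hρc _

/-- The closed support of `∂̄ρ · w_{a,b}` lies in that of `ρ`. [cite: Forster1981, §20.5] -/
theorem tsupport_dbarAlong_mul_arcLog_subset (ρ : ℂ → ℂ) (a b : ℂ) :
    tsupport (fun z ↦ dbarAlong 1 ρ z * arcLog a b z) ⊆ tsupport ρ :=
  (tsupport_mul_subset_left).trans (tsupport_dbarAlong_one_subset ρ)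

end Coefficient

/-! ### The weak solution `u` of `∂[a,b] = b - a` -/

section WeakSolution

open Classical in
/-- **The weak solution of the divisor `b - a` of the arc `[a, b]`** attached to a cut-off `ρ` and a
disc `B(c₀, r₁) ⊇ [a,b]`: `(z - b)/(z - a)` on the disc and `exp(2πi ρ(z) w_{a,b}(z))` outside
(Forster's `f₀`; the two agree near the boundary circle when `ρ = 1` on a larger disc).
[cite: Forster1981, §20.5, proof (a)] -/
def arcUnit (ρ : ℂ → ℂ) (a b c₀ : ℂ) (r₁ : ℝ) (z : ℂ) : ℂ :=
  if z ∈ ball c₀ r₁ then (z - b) / (z - a) else Complex.exp (2 * π * I * (ρ z * arcLog a b z))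

variable {ρ : ℂ → ℂ} {a b c₀ : ℂ} {r₀ r₁ r₂ : ℝ}

/-- On the disc `B(c₀, r₁)` the weak solution is `(z - b)/(z - a)`. [cite: Forster1981, §20.5, proof (a)] -/
theorem arcUnit_of_mem {z : ℂ} (hz : z ∈ ball c₀ r₁) :
    arcUnit ρ a b c₀ r₁ z = (z - b) / (z - a) := by
  simp [arcUnit, hz]

/-- Off the disc `B(c₀, r₁)` the weak solution is `exp(2πi ρ w_{a,b})`. [cite: Forster1981, §20.5, proof (a)] -/
theorem arcUnit_of_not_mem {z : ℂ} (hz : z ∉ ball c₀ r₁) :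
    arcUnit ρ a b c₀ r₁ z = Complex.exp (2 * π * I * (ρ z * arcLog a b z)) := by
  simp [arcUnit, hz]

/-- Near the disc (indeed on it) the weak solution is eventually `(z - b)/(z - a)`: at every point of
`B(c₀, r₁)`. [cite: Forster1981, §20.5, proof (a)] -/
theorem arcUnit_eventuallyEq_div {z : ℂ} (hz : z ∈ ball c₀ r₁) :
    arcUnit ρ a b c₀ r₁ =ᶠ[𝓝 z] fun y ↦ (y - b) / (y - a) := by
  filter_upwards [isOpen_ball.mem_nhds hz] with y hy using arcUnit_of_mem hy

/-- The weak solution vanishes at `b` (when `b` lies in the disc). [cite: Forster1981, §20.4] -/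
theorem arcUnit_apply_right (hb : b ∈ ball c₀ r₁) : arcUnit ρ a b c₀ r₁ b = 0 := by
  rw [arcUnit_of_mem hb, sub_self, zero_div]

/-- **Off the cut `[a, b]` the weak solution is `exp(2πi ρ w_{a,b})`**, provided `a, b ∈ B(c₀, r₀)`,
`r₁ ≤ r₂` and `ρ = 1` on `B(c₀, r₂) ⊇ B(c₀, r₁)` (on the disc, off the cut,
`(z-b)/(z-a) = exp(2πi w_{a,b})`). [cite: Forster1981, §20.5, proof (a)] -/
theorem arcUnit_eq_exp_of_not_mem_segment (h₁₂ : r₁ ≤ r₂) (hρ1 : ∀ z ∈ ball c₀ r₂, ρ z = 1)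
    {z : ℂ} (hz : z ∉ segment ℝ a b) :
    arcUnit ρ a b c₀ r₁ z = Complex.exp (2 * π * I * (ρ z * arcLog a b z)) := by
  have hza : z ≠ a := fun h ↦ hz (h ▸ left_mem_segment ℝ z b)
  have hzb : z ≠ b := fun h ↦ hz (h ▸ right_mem_segment ℝ a z)
  by_cases hz₁ : z ∈ ball c₀ r₁
  · rw [arcUnit_of_mem hz₁, hρ1 z (ball_subset_ball h₁₂ hz₁), one_mul,
      exp_two_pi_I_mul_arcLog hza hzb]
  · exact arcUnit_of_not_mem hz₁

/-- Off the cut, the weak solution agrees with `exp(2πi ρ w_{a,b})` on a neighbourhood.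
[cite: Forster1981, §20.5, proof (a)] -/
theorem arcUnit_eventuallyEq_exp (h₁₂ : r₁ ≤ r₂) (hρ1 : ∀ z ∈ ball c₀ r₂, ρ z = 1)
    {z : ℂ} (hz : z ∉ segment ℝ a b) :
    arcUnit ρ a b c₀ r₁ =ᶠ[𝓝 z] fun y ↦ Complex.exp (2 * π * I * (ρ y * arcLog a b y)) := by
  filter_upwards [(isClosed_segment' a b).isOpen_compl.mem_nhds hz] with y hy
    using arcUnit_eq_exp_of_not_mem_segment h₁₂ hρ1 hy

/-- **The weak solution is `C^∞` off `a`** (over `ℝ`). [cite: Forster1981, §20.4] -/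
theorem contDiffAt_arcUnit (hρ : ContDiff ℝ ∞ ρ) (h₀₁ : r₀ < r₁) (h₁₂ : r₁ ≤ r₂)
    (hρ1 : ∀ z ∈ ball c₀ r₂, ρ z = 1) (ha : a ∈ ball c₀ r₀) (hb : b ∈ ball c₀ r₀) {z : ℂ}
    (hza : z ≠ a) : ContDiffAt ℝ ∞ (arcUnit ρ a b c₀ r₁) z := by
  by_cases hz : z ∈ segment ℝ a b
  · have hz₁ : z ∈ ball c₀ r₁ := ball_subset_ball h₀₁.le ((convex_ball c₀ r₀).segment_subset ha hb hz)
    refine ContDiffAt.congr_of_eventuallyEq ?_ (arcUnit_eventuallyEq_div hz₁)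
    have h1 : ContDiffAt ℂ ∞ (fun y : ℂ ↦ (y - b) / (y - a)) z :=
      (contDiffAt_id.sub contDiffAt_const).div (contDiffAt_id.sub contDiffAt_const)
        (sub_ne_zero.2 hza)
    exact h1.restrict_scalars ℝ
  · refine ContDiffAt.congr_of_eventuallyEq ?_ (arcUnit_eventuallyEq_exp h₁₂ hρ1 hz)
    exact (Complex.contDiff_exp (𝕜 := ℝ) (n := ∞)).contDiffAt.comp z
      (contDiffAt_const.mul (hρ.contDiffAt.mul (contDiffAt_arcLog hz)))

/-- The weak solution is real-differentiable off `a`. [cite: Forster1981, §20.4] -/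
theorem differentiableAt_arcUnit (hρ : ContDiff ℝ ∞ ρ) (h₀₁ : r₀ < r₁) (h₁₂ : r₁ ≤ r₂)
    (hρ1 : ∀ z ∈ ball c₀ r₂, ρ z = 1) (ha : a ∈ ball c₀ r₀) (hb : b ∈ ball c₀ r₀) {z : ℂ}
    (hza : z ≠ a) : DifferentiableAt ℝ (arcUnit ρ a b c₀ r₁) z :=
  (contDiffAt_arcUnit hρ h₀₁ h₁₂ hρ1 ha hb hza).differentiableAt (by simp)

/-- **The weak solution does not vanish off `{a, b}`.** [cite: Forster1981, §20.4] -/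
theorem arcUnit_ne_zero {z : ℂ} (hza : z ≠ a) (hzb : z ≠ b) : arcUnit ρ a b c₀ r₁ z ≠ 0 := by
  by_cases hz₁ : z ∈ ball c₀ r₁
  · rw [arcUnit_of_mem hz₁]
    exact div_ne_zero (sub_ne_zero.2 hzb) (sub_ne_zero.2 hza)
  · rw [arcUnit_of_not_mem hz₁]
    exact Complex.exp_ne_zero _

/-- **The weak solution is `1` where the cut-off vanishes** (off the disc). [cite: Forster1981, §20.5] -/
theorem arcUnit_eq_one {z : ℂ} (hz : z ∉ ball c₀ r₁) (h0 : ρ z = 0) : arcUnit ρ a b c₀ r₁ z = 1 := by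
  rw [arcUnit_of_not_mem hz, h0, zero_mul, mul_zero, Complex.exp_zero]

/-- The weak solution is holomorphic on the disc off `a`. [cite: Forster1981, §20.4] -/
theorem differentiableAt_complex_arcUnit_of_mem {z : ℂ} (hz : z ∈ ball c₀ r₁) (hza : z ≠ a) :
    DifferentiableAt ℂ (arcUnit ρ a b c₀ r₁) z := by
  refine DifferentiableAt.congr_of_eventuallyEq ?_ (arcUnit_eventuallyEq_div hz)
  exact (differentiableAt_id.sub_const b).div (differentiableAt_id.sub_const a) (sub_ne_zero.2 hza)

/-- **The logarithmic `∂̄`-derivative of the weak solution: `∂̄u = 2πi (∂̄ρ · w_{a,b}) u`** at every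
`z ≠ a` (off the cut `u = exp(2πi ρ w)` with `∂̄w = 0`; on the disc `u` is holomorphic and
`∂̄ρ = 0`). This is Forster's «`σ = f⁻¹ ∂̄f / 2πi` is a smooth `(0,1)`-form with compact support».
[cite: Forster1981, §20.4] -/
theorem dbarAlong_arcUnit (hρ : ContDiff ℝ ∞ ρ) (h₀₁ : r₀ < r₁) (h₁₂ : r₁ ≤ r₂)
    (hρ1 : ∀ z ∈ ball c₀ r₂, ρ z = 1) (ha : a ∈ ball c₀ r₀) (hb : b ∈ ball c₀ r₀) {z : ℂ}
    (hza : z ≠ a) :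
    dbarAlong 1 (arcUnit ρ a b c₀ r₁) z =
      2 * π * I * (dbarAlong 1 ρ z * arcLog a b z) * arcUnit ρ a b c₀ r₁ z := by
  have hρd : DifferentiableAt ℝ ρ z := hρ.contDiffAt.differentiableAt (by simp)
  by_cases hz : z ∈ segment ℝ a b
  · -- on the disc: holomorphic, and `∂̄ρ = 0`
    have hz₁ : z ∈ ball c₀ r₁ := ball_subset_ball h₀₁.le ((convex_ball c₀ r₀).segment_subset ha hb hz)
    rw [dbarAlong_eq_zero_of_differentiableAt (differentiableAt_complex_arcUnit_of_mem hz₁ hza) 1,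
      dbarAlong_eq_zero_of_eqOn_ball hρ1 (ball_subset_ball h₁₂ hz₁)]
    ring
  · -- off the cut: `u = exp(2πi ρ w)`
    have hw : DifferentiableAt ℝ (arcLog a b) z :=
      (contDiffAt_arcLog (n := ∞) hz).differentiableAt (by simp)
    have hH : DifferentiableAt ℝ (fun y ↦ 2 * π * I * (ρ y * arcLog a b y)) z :=
      (hρd.mul hw).const_mul _
    rw [dbarAlong_congr_of_eventuallyEq (arcUnit_eventuallyEq_exp h₁₂ hρ1 hz) 1, dbarAlong_one_cexp hH,
      ← arcUnit_eq_exp_of_not_mem_segment h₁₂ hρ1 hz]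
    have hprod : dbarAlong 1 (fun y ↦ 2 * π * I * (ρ y * arcLog a b y)) z =
        2 * π * I * (dbarAlong 1 ρ z * arcLog a b z) := by
      have hρw : DifferentiableAt ℝ (fun y ↦ ρ y * arcLog a b y) z := hρd.mul hw
      rw [dbarAlong_one_mul (differentiableAt_const (2 * π * I : ℂ)) hρw, dbarAlong_one_mul hρd hw,
        dbarAlong_arcLog_eq_zero hz,
        dbarAlong_eq_zero_of_differentiableAt (differentiableAt_const (2 * π * I : ℂ)) 1]
      ring
    rw [hprod]
    ring

end WeakSolution

end Literature.Analysis.Complex
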